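import Mathlib.Algebra.Order.Floor.Semiring
import Mathlib.Algebra.Order.Archimedean.Basic
import Mathlib.Analysis.SpecialFunctions.Pow.Real
import Mathlib.Tactic
import Literature.Combinatorics.HalesJewett.SubspaceToolkit
import Literature.Combinatorics.HalesJewett.Word
import Literature.Combinatorics.HalesJewett.Subspace
import Literature.Combinatorics.HalesJewett.DensityHalesJewett
import Literature.Combinatorics.HalesJewett.DKTGrahamRothschild
import HarnessLib

/-!
# Combinatorial subspaces, densities, and the first steps of the density Hales–Jewett theorem

Topic `Literature/Combinatorics/HalesJewett`. Infrastructure for the proof of the density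
Hales–Jewett theorem (the tree's named fact `DensityHalesJewett`, file `DensityHalesJewett.lean`)
along P. Dodos, V. Kanellopoulos, K. Tyros, *A simple proof of the density Hales–Jewett theorem*,
Int. Math. Res. Not. IMRN 2014 (12), 3340–3352 (= arXiv:1209.4986, cited `DKT` below), on top of
Mathlib's `Combinatorics.Line` / `Combinatorics.Subspace` (`Mathlib/Combinatorics/HalesJewett.lean`) and the tree's
`SubspaceToolkit.lean` (`Subspace.comp`, `Subspace.line`, `Subspace.pat`, `Subspace.mapLetters`,
`Subspace.injective`, Hales–Jewett in every large dimension) and `Word.lean` (`fiber`).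

Part of a COMPLETE, sorry-free formalisation of DKT's proof INCLUDING a proof of the
Graham–Rothschild theorem for lines (files `DKTGrahamRothschild`, `DKTGrahamRothschildProof`,
`DKTSubspaces`, `DKTCorrelation`, `DensityHalesJewettProofs`), ending in
`DensityHalesJewett_holds`, `SzemerediTheorem_holds` and Green–Tao's Theorem 1.1
(`exists_prime_arithmetic_progression_holds`, file `NumberTheory/Sieve/ParityWave0GreenTaoHolds.lean`).

## Encoding (design choices)

* Alphabet `[k]` = an arbitrary finite type `α` (`k = |α|`); the extended alphabet `[k+1]` is
  `Option α`, the new letter being `none` — so that a combinatorial line of `α^ι` (Mathlib: a word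
  `ι → Option α` with at least one wildcard `none`) *is* a word of `(Option α)^ι` (Polymath 2012,
  p. 1284: "there is a close relationship between lines in `[k]^n` and points in `[k+1]^n`").
* Coordinates `[n]` = an arbitrary finite type `ι` (in `Type`); concatenation
  `[k]^l × [k]^{n-l}` is a sum of coordinate types `ι₁ ⊕ ι₂` (as in Mathlib's proof of the
  Hales–Jewett theorem); a splitting of `ι` is an equivalence `ι ≃ β ⊕ γ` and sets of words are
  moved along it by `transport`.
* `m`-dimensional subspaces are Mathlib's `Subspace (Fin m) α ι`; the lines "of `V`" (DKT:
  `Lines(V)`) are the toolkit's `Subspace.line V ℓ`, `ℓ` a line of `α^{Fin m}`; `V ↾ k` for `V`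
  over `Option α` is `{V (some ∘ z)}`; `Subspace.mapLetters some V` views a subspace over `α` over
  `Option α`.
* Densities: `rdens A` is by definition (`rfl`) the real cast `(A.dens : ℝ)` of Mathlib's
  `Finset.dens` — the convention of `Word.lean` (`average_density_fiber`) and `Subspace.lean`
  (`relativeDensity`); its few lemmas are the real-cast forms of the `Finset.dens` API, each a
  one-liner; fibres are `Word.lean`'s `fiber A x = {y : x ⌢ y ∈ A}`.

## Contents

* API (beyond the toolkit and the port's `Subspace.lean`): `Subspace.horiz`/`vert`/`idSubspace`/`snoc`,
  `lineWords` and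
  `card_lineWords` (`#lines of [k]^m = (k+1)^m - k^m`), `rdens`, `fiber`,
  `rdens_eq_sum_rdens_fiber_div`, Markov-type averaging lemmas, `transport`, reindexing.
* `DHJ α`, `MDHJ α m`: the density Hales–Jewett property of the alphabet `α` (type-generic form of
  DKT Thm. 1 / Polymath Thm. 1.4) and its multidimensional version — the INDUCTION PREDICATES of
  the proof, not facts to be assumed; `densityHalesJewett_of_dhj` bridges to the tree's named fact
  `DensityHalesJewett` (`DensityHalesJewett.lean`).
* DKT Lemma 4 (`uniformization`), DKT Proposition 3 (`mdhj_of_dhj`: `DHJ α → MDHJ α m`) and DKT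
  Corollary 5 (`mdhjStar_of_dhj`), all PROVED.

## References
* P. Dodos, V. Kanellopoulos, K. Tyros, IMRN 2014 (12), 3340–3352, §§2–3. [cite: DodosKanellopoulosTyros2014]
* D. H. J. Polymath, Ann. of Math. 175 (2012), 1283–1327, §1. [cite: Polymath2012DHJ]
-/

open Combinatorics Finset

namespace Literature.Combinatorics.HalesJewett


variable {η η' α ι ι' : Type*}

/-! ### Subspaces as injective maps; composition -/

/-! ### Products over a splitting of the coordinates `ι ⊕ ι'` -/

/-- The subspace `V ⌢ y` of `ι ⊕ ι' → α`: `V` on the first coordinates, the constant word `y` on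
the second (DKT: `V^⌢ y`). [cite: DodosKanellopoulosTyros2014, Section 2] -/
def Subspace.horiz (V : Subspace η α ι) (y : ι' → α) : Subspace η α (ι ⊕ ι') where
  idxFun := Sum.elim V.idxFun (Sum.inl ∘ y)
  proper e := by
    obtain ⟨i, hi⟩ := V.proper e
    exact ⟨Sum.inl i, hi⟩

/-- `(V ⌢ y)(x) = V(x) ⌢ y`. [folklore] -/
@[simp] theorem Subspace.horiz_apply (V : Subspace η α ι) (y : ι' → α) (x : η → α) :
    ⇑(Subspace.horiz V y) x = Sum.elim (V x) y := by
  funext i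
  cases i <;> simp [Subspace.horiz, Subspace.coe_apply]

/-- The subspace `x ⌢ V` of `ι ⊕ ι' → α`: the constant word `x` first, then `V`
(DKT: `x^⌢ V`). [cite: DodosKanellopoulosTyros2014, Section 2] -/
def Subspace.vert (x : ι → α) (V : Subspace η α ι') : Subspace η α (ι ⊕ ι') where
  idxFun := Sum.elim (Sum.inl ∘ x) V.idxFun
  proper e := by
    obtain ⟨i, hi⟩ := V.proper e
    exact ⟨Sum.inr i, hi⟩

/-- `(x ⌢ V)(z) = x ⌢ V(z)`. [folklore] -/
@[simp] theorem Subspace.vert_apply (x : ι → α) (V : Subspace η α ι') (z : η → α) :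
    ⇑(Subspace.vert x V) z = Sum.elim x (V z) := by
  funext i
  cases i <;> simp [Subspace.vert, Subspace.coe_apply]

/-- The identity subspace of `ι → α` (all of the cube, dimension `ι`); this is Mathlib's
`default : Subspace ι α ι` (`HalesJewett.lean`), given a name and an `apply` lemma. [folklore] -/
def Subspace.idSubspace (α ι : Type*) : Subspace ι α ι where
  idxFun := Sum.inr
  proper i := ⟨i, rfl⟩

/-- The identity subspace is the identity map. [folklore] -/
@[simp] theorem Subspace.idSubspace_apply (x : ι → α) : ⇑(Subspace.idSubspace α ι) x = x := by
  funext i; simp [Subspace.idSubspace, Subspace.coe_apply]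


/-! ### Lines as words over the extended alphabet -/

/-- The words over `Option α` (wildcard `none`) with at least one wildcard: exactly the words
`ℓ.idxFun` of the combinatorial lines `ℓ` of `η → α` (Polymath 2012, p. 1284: "there is a close
relationship between lines in `[k]^n` and points in `[k+1]^n`"). [cite: Polymath2012DHJ, §1.1 (p. 1284)] -/
def lineWords (α η : Type*) [Fintype α] [DecidableEq α] [Fintype η] [DecidableEq η] :
    Finset (η → Option α) :=
  univ.filter fun w => ∃ e, w e = none

/-- Membership in `lineWords`. [folklore] -/
@[simp] theorem mem_lineWords [Fintype α] [DecidableEq α] [Fintype η] [DecidableEq η]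
    {w : η → Option α} : w ∈ lineWords α η ↔ ∃ e, w e = none := by
  simp [lineWords]

/-- The word of a line is a line word. [folklore] -/
theorem idxFun_mem_lineWords [Fintype α] [DecidableEq α] [Fintype η] [DecidableEq η]
    (l : Line α η) : l.idxFun ∈ lineWords α η :=
  mem_lineWords.2 l.proper

/-- The number of combinatorial lines of `[k]^m` is `(k+1)^m - k^m`.
[cite: DodosKanellopoulosTyros2014, proof of Lemma 7] -/
theorem card_lineWords [Fintype α] [DecidableEq α] [Fintype η] [DecidableEq η] :
    #(lineWords α η) = (Fintype.card α + 1) ^ Fintype.card η - Fintype.card α ^ Fintype.card η := by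
  have htot : #(lineWords α η) + #(univ.filter fun w : η → Option α => ¬ ∃ e, w e = none) =
      (Fintype.card α + 1) ^ Fintype.card η := by
    rw [lineWords, card_filter_add_card_filter_not, card_univ, Fintype.card_fun,
      Fintype.card_option]
  have hnone : #(univ.filter fun w : η → Option α => ¬ ∃ e, w e = none) =
      Fintype.card α ^ Fintype.card η := by
    have : (univ.filter fun w : η → Option α => ¬ ∃ e, w e = none) =
        univ.map ⟨fun z : η → α => some ∘ z, fun z z' h => by
          funext e; exact Option.some_injective _ (congrFun h e)⟩ := by
      ext w
      simp only [mem_filter, mem_univ, true_and, mem_map, Function.Embedding.coeFn_mk, not_exists]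
      constructor
      · intro hw
        refine ⟨fun e => (w e).get (Option.ne_none_iff_isSome.1 (hw e)), ?_⟩
        funext e; simp
      · rintro ⟨z, rfl⟩ e
        simp
    rw [this, card_map, card_univ, Fintype.card_fun]
  omega

/-! ### Densities (the topic convention: real casts of `Finset.dens`) -/

/-- The real-valued density `rdens A = (A.dens : ℝ) = #A / k^n` of `A ⊆ [k]^n` (DKT: `dens(A)`): BY
DEFINITION the topic's convention, the cast to `ℝ` of Mathlib's `Finset.dens` (as in `Word.lean`'s
`average_density_fiber`, `Subspace.lean`'s `relativeDensity`); `rdens_eq_cast_dens : rdens A = A.dens`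
is `rfl`. (A `def` rather than an `abbrev` only so that `push_cast`/`norm_cast` do not unfold
densities inside the real estimates below.) The lemmas below are the real-cast forms of Mathlib's
`Finset.dens` API, each derived in one line. [cite: DodosKanellopoulosTyros2014, Section 1] -/
noncomputable def rdens [Fintype α] [Fintype ι] [DecidableEq ι] (A : Finset (ι → α)) : ℝ :=
  ((Finset.dens A : ℚ≥0) : ℝ)

/-- Bridge (by `rfl`): `rdens A` IS the real cast of `Finset.dens A`. [folklore] -/
@[simp] theorem rdens_eq_cast_dens [Fintype α] [Fintype ι] [DecidableEq ι] (A : Finset (ι → α)) :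
    rdens A = ((Finset.dens A : ℚ≥0) : ℝ) := rfl

section Density

variable [Fintype α] [Fintype ι] [DecidableEq ι]

/-- `rdens A = #A / |cube|` (real cast of `Finset.dens`, `Finset.nnratCast_dens`). [folklore] -/
theorem rdens_def (A : Finset (ι → α)) : rdens A = #A / Fintype.card (ι → α) :=
  Finset.nnratCast_dens A

/-- `0 ≤ rdens A`. [folklore] -/
theorem rdens_nonneg (A : Finset (ι → α)) : 0 ≤ rdens A := NNRat.cast_nonneg _

/-- `rdens A ≤ 1` (`Finset.dens_le_one`). [folklore] -/
theorem rdens_le_one (A : Finset (ι → α)) : rdens A ≤ 1 := by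
  unfold rdens; exact_mod_cast A.dens_le_one

/-- Monotonicity (`Finset.dens_le_dens`). [folklore] -/
theorem rdens_mono {A B : Finset (ι → α)} (h : A ⊆ B) : rdens A ≤ rdens B := by
  unfold rdens; exact_mod_cast Finset.dens_le_dens h

/-- The cube has positive size when the alphabet is nonempty. [folklore] -/
theorem card_cube_pos [Nonempty α] : 0 < Fintype.card (ι → α) := Fintype.card_pos

/-- `#A = rdens A · |cube|` (`Finset.dens_mul_card`, real form). [folklore] -/
theorem card_eq_rdens_mul [Nonempty α] (A : Finset (ι → α)) :
    (#A : ℝ) = rdens A * Fintype.card (ι → α) := by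
  have : (0 : ℝ) < Fintype.card (ι → α) := by exact_mod_cast card_cube_pos
  rw [rdens_def]; field_simp

/-- `rdens univ = 1` (`Finset.dens_univ`). [folklore] -/
theorem rdens_univ [Nonempty α] : rdens (univ : Finset (ι → α)) = 1 := by
  unfold rdens; exact_mod_cast Finset.dens_univ

/-- `rdens (A ∪ B) ≤ rdens A + rdens B` (`Finset.dens_union_le`). [folklore] -/
theorem rdens_union_le [DecidableEq α] (A B : Finset (ι → α)) : rdens (A ∪ B) ≤ rdens A + rdens B := by
  unfold rdens; exact_mod_cast Finset.dens_union_le A B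

/-- `rdens A - rdens B ≤ rdens (A \ B)` (real form; in `ℚ≥0` this is `Finset.le_dens_sdiff` with
truncated subtraction). [folklore] -/
theorem rdens_sdiff_ge [DecidableEq α] (A B : Finset (ι → α)) : rdens A - rdens B ≤ rdens (A \ B) := by
  rw [rdens_def, rdens_def, rdens_def, ← sub_div]
  gcongr
  have h2 : #A - #B ≤ #(A \ B) := le_card_sdiff B A
  exact_mod_cast (by omega : (#A : ℤ) - #B ≤ #(A \ B))

/-- `rdens Aᶜ = 1 - rdens A` (`Finset.dens_compl`, real form). [folklore] -/
theorem rdens_compl [DecidableEq α] [Nonempty α] (A : Finset (ι → α)) : rdens Aᶜ = 1 - rdens A := by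
  have : (0 : ℝ) < Fintype.card (ι → α) := by exact_mod_cast card_cube_pos
  rw [rdens_def, rdens_def, card_compl, Nat.cast_sub (card_le_univ A), sub_div, div_self this.ne']

/-- `rdens A ≤ rdens (A ∩ B) + rdens Bᶜ`. [folklore] -/
theorem rdens_le_rdens_inter_add [DecidableEq α] [Nonempty α] (A B : Finset (ι → α)) :
    rdens A ≤ rdens (A ∩ B) + rdens Bᶜ := by
  calc rdens A ≤ rdens ((A ∩ B) ∪ Bᶜ) := rdens_mono (by
          intro x hx
          by_cases hB : x ∈ B
          · exact mem_union_left _ (mem_inter.2 ⟨hx, hB⟩)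
          · exact mem_union_right _ (mem_compl.2 hB))
    _ ≤ rdens (A ∩ B) + rdens Bᶜ := rdens_union_le _ _

end Density

/-! ### Fibres over a splitting of the coordinates -/

/-- `#A = ∑_x #A_x`. [folklore] -/
theorem card_eq_sum_card_fiber [Fintype α] [DecidableEq α] [Fintype ι] [DecidableEq ι] [Fintype ι']
    [DecidableEq ι'] (A : Finset (ι ⊕ ι' → α)) : #A = ∑ x : ι → α, #(fiber A x) := by
  rw [card_eq_sum_card_fiberwise (f := fun w : ι ⊕ ι' → α => w ∘ Sum.inl) (t := univ)
    (fun _ _ => mem_univ _)]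
  refine sum_congr rfl fun x _ => ?_
  refine card_nbij' (fun w => w ∘ Sum.inr) (fun y => Sum.elim x y) ?_ ?_ ?_ ?_
  · intro w hw
    rw [mem_coe, mem_filter] at hw
    rw [mem_coe, mem_fiber, ← hw.2, Sum.elim_comp_inl_inr]
    exact hw.1
  · intro y hy
    rw [mem_coe, mem_fiber] at hy
    rw [mem_coe, mem_filter]
    exact ⟨hy, Sum.elim_comp_inl x y⟩
  · intro w hw
    rw [mem_coe, mem_filter] at hw
    simp only []
    rw [← hw.2]
    exact Sum.elim_comp_inl_inr w
  · intro y _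
    exact Sum.elim_comp_inr x y

/-- `rdens A = E_x rdens(A_x)`: the density is the average of the fibre densities — the `∑`-form
of `Word.lean`'s `average_density_fiber` (`𝔼` unfolded). [cite: DodosKanellopoulosTyros2014, proof of Proposition 3] -/
theorem rdens_eq_sum_rdens_fiber_div [Fintype α] [DecidableEq α] [Fintype ι] [DecidableEq ι] [Fintype ι']
    [DecidableEq ι'] (A : Finset (ι ⊕ ι' → α)) :
    rdens A = (∑ x : ι → α, rdens (fiber A x)) / Fintype.card (ι → α) := by
  unfold rdens
  rw [← average_density_fiber A, Finset.expect_eq_sum_div_card, Finset.card_univ]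

/-! ### Averaging (Markov-type) lemmas -/

/-- If `f ≤ 1` on `s` and `∑_s f ≥ δ #s` then at least `(δ - t) #s` elements have `f ≥ t`
(`t ≥ 0`). [folklore] -/
theorem le_card_filter_of_le_sum {X : Type*} (s : Finset X) (f : X → ℝ) (hf : ∀ x ∈ s, f x ≤ 1)
    {δ t : ℝ} (ht : 0 ≤ t) (h : δ * #s ≤ ∑ x ∈ s, f x) :
    (δ - t) * #s ≤ #(s.filter fun x => t ≤ f x) := by
  classical
  have hsplit := sum_filter_add_sum_filter_not s (fun x => t ≤ f x) f
  have h1 : ∑ x ∈ s.filter (fun x => t ≤ f x), f x ≤ #(s.filter fun x => t ≤ f x) := by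
    calc ∑ x ∈ s.filter (fun x => t ≤ f x), f x ≤ ∑ x ∈ s.filter (fun x => t ≤ f x), (1 : ℝ) :=
          sum_le_sum fun x hx => hf x (mem_filter.1 hx).1
      _ = _ := by rw [sum_const, nsmul_eq_mul, mul_one]
  have h2 : ∑ x ∈ s.filter (fun x => ¬ t ≤ f x), f x ≤ t * #s := by
    calc ∑ x ∈ s.filter (fun x => ¬ t ≤ f x), f x ≤ ∑ x ∈ s.filter (fun x => ¬ t ≤ f x), t :=
          sum_le_sum fun x hx => (not_le.1 (mem_filter.1 hx).2).le
      _ = t * #(s.filter fun x => ¬ t ≤ f x) := by rw [sum_const, nsmul_eq_mul, mul_comm]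
      _ ≤ t * #s := by gcongr; exact filter_subset _ _
  nlinarith

/-- If `f ≤ M` on `s` and `∑_s f ≥ m #s`, then the elements with `f < m - u` are few:
`#{f < m - u} · u ≤ (M - m) #s`. [folklore] -/
theorem card_filter_lt_mul_le {X : Type*} (s : Finset X) (f : X → ℝ) {M m u : ℝ}
    (hf : ∀ x ∈ s, f x ≤ M) (h : m * #s ≤ ∑ x ∈ s, f x) :
    (#(s.filter fun x => f x < m - u) : ℝ) * u ≤ (M - m) * #s := by
  classical
  have hsplit := sum_filter_add_sum_filter_not s (fun x => f x < m - u) f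
  have h1 : ∑ x ∈ s.filter (fun x => f x < m - u), f x ≤
      (m - u) * #(s.filter fun x => f x < m - u) := by
    calc ∑ x ∈ s.filter (fun x => f x < m - u), f x
          ≤ ∑ x ∈ s.filter (fun x => f x < m - u), (m - u) :=
          sum_le_sum fun x hx => (mem_filter.1 hx).2.le
      _ = _ := by rw [sum_const, nsmul_eq_mul, mul_comm]
  have h2 : ∑ x ∈ s.filter (fun x => ¬ f x < m - u), f x ≤
      M * #(s.filter fun x => ¬ f x < m - u) := by
    calc ∑ x ∈ s.filter (fun x => ¬ f x < m - u), f x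
          ≤ ∑ x ∈ s.filter (fun x => ¬ f x < m - u), M :=
          sum_le_sum fun x hx => hf x (mem_filter.1 hx).1
      _ = _ := by rw [sum_const, nsmul_eq_mul, mul_comm]
  have hcard : (#(s.filter fun x => f x < m - u) : ℝ) + #(s.filter fun x => ¬ f x < m - u) = #s := by
    exact_mod_cast card_filter_add_card_filter_not (fun x => f x < m - u)
  have hA : (0 : ℝ) ≤ #(s.filter fun x => f x < m - u) := by positivity
  have hB : (0 : ℝ) ≤ #(s.filter fun x => ¬ f x < m - u) := by positivity
  have hK : (#(s.filter fun x => ¬ f x < m - u) : ℝ) = #s - #(s.filter fun x => f x < m - u) := by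
    linarith
  rw [hK, mul_sub] at h2
  have hkey : (M - m + u) * #(s.filter fun x => f x < m - u) ≤ (M - m) * #s := by nlinarith
  by_cases hmM : m ≤ M
  · nlinarith [mul_nonneg (sub_nonneg.2 hmM) hA]
  · have hsum : ∑ x ∈ s, f x ≤ M * #s := by
      calc ∑ x ∈ s, f x ≤ ∑ _x ∈ s, M := sum_le_sum hf
        _ = M * #s := by rw [sum_const, nsmul_eq_mul, mul_comm]
    have hs0 : (#s : ℝ) = 0 := by
      have : (0 : ℝ) ≤ #s := by positivity
      nlinarith
    have hL0 : (#(s.filter fun x => f x < m - u) : ℝ) = 0 := by linarith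
    rw [hL0, hs0]; simp




/-! ### Transport along an equivalence of coordinates -/

/-- Transport of a set of words along `e : ι ≃ ι'`: `w ↦ w ∘ e⁻¹`. [folklore] -/
def transport {α ι ι' : Type*} (e : ι ≃ ι') (A : Finset (ι → α)) : Finset (ι' → α) :=
  A.map ⟨fun w => w ∘ e.symm, fun w w' h => by
    funext i; simpa using congrFun h (e i)⟩

/-- `w ∈ transport e A ↔ w ∘ e ∈ A`. [folklore] -/
@[simp] theorem mem_transport {α ι ι' : Type*} (e : ι ≃ ι') (A : Finset (ι → α)) (w : ι' → α) :
    w ∈ transport e A ↔ w ∘ e ∈ A := by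
  simp only [transport, mem_map, Function.Embedding.coeFn_mk]
  constructor
  · rintro ⟨v, hv, rfl⟩
    have : (v ∘ e.symm) ∘ e = v := by funext i; simp
    rwa [this]
  · intro h
    exact ⟨w ∘ e, h, by funext i; simp⟩

/-- `#(transport e A) = #A`. [folklore] -/
@[simp] theorem card_transport {α ι ι' : Type*} (e : ι ≃ ι') (A : Finset (ι → α)) :
    #(transport e A) = #A := card_map _

/-- Transport preserves density. [folklore] -/
@[simp] theorem rdens_transport {α ι ι' : Type*} [Fintype α] [Fintype ι] [DecidableEq ι] [Fintype ι']
    [DecidableEq ι'] (e : ι ≃ ι') (A : Finset (ι → α)) : rdens (transport e A) = rdens A := by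
  rw [rdens_def, rdens_def, card_transport, Fintype.card_fun, Fintype.card_fun, Fintype.card_congr e]

/-! ### Splitting off coordinates -/

/-- A finite type with at least `M` elements splits as `Fin n ⊕ Fin M`. [folklore] -/
theorem exists_equiv_sum_fin (ι : Type*) [Fintype ι] {M : ℕ} (hM : M ≤ Fintype.card ι) :
    ∃ (n : ℕ) (_ : ι ≃ Fin n ⊕ Fin M), n + M = Fintype.card ι := by
  refine ⟨Fintype.card ι - M, (Fintype.equivFin ι).trans
    ((finCongr (by omega)).trans finSumFinEquiv.symm), by omega⟩

/-! ### The density Hales–Jewett property of an alphabet, and its multidimensional version -/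

/-- `DHJ α`: the density Hales–Jewett property of the alphabet `α` — for every `δ > 0` there is
`N` such that for every coordinate set `ι` with `|ι| ≥ N`, every `A ⊆ α^ι` of density `≥ δ`
contains a combinatorial line. This is the per-alphabet INDUCTION PREDICATE of the
Dodos–Kanellopoulos–Tyros proof (type-generic form of DKT Thm. 1, `k = |α|`), NOT a fact to be
assumed: the tree's named fact is `DensityHalesJewett` (file `DensityHalesJewett.lean`), which
follows from `∀ k ≥ 1, DHJ (Fin k)` by `densityHalesJewett_of_dhj` below and is proved (from the
Graham–Rothschild theorem for lines) in `DensityHalesJewettProofs.lean`.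
[cite: DodosKanellopoulosTyros2014, Theorem 1] -/
def DHJ (α : Type) [Fintype α] : Prop :=
  ∀ δ : ℝ, 0 < δ → ∃ N : ℕ, ∀ (ι : Type) [Fintype ι] [DecidableEq ι], N ≤ Fintype.card ι →
    ∀ A : Finset (ι → α), δ ≤ rdens A → ∃ l : Line α ι, ∀ a, l a ∈ A

/-- `MDHJ α m`: the multidimensional density Hales–Jewett property (induction predicate, as
`DHJ`) — dense sets contain `m`-dimensional combinatorial subspaces.
[cite: DodosKanellopoulosTyros2014, Proposition 3] -/
def MDHJ (α : Type) [Fintype α] (m : ℕ) : Prop :=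
  ∀ δ : ℝ, 0 < δ → ∃ N : ℕ, ∀ (ι : Type) [Fintype ι] [DecidableEq ι], N ≤ Fintype.card ι →
    ∀ A : Finset (ι → α), δ ≤ rdens A → ∃ V : Subspace (Fin m) α ι, ∀ x, V x ∈ A

/-- **Bridge to the tree's named fact.** `DensityHalesJewett` (Polymath 2012 Thm. 1.4, stated for
`A ⊆ [k]^n` as `Finset (Fin n → Fin k)` with `δ k^n ≤ #A`) follows from the per-alphabet
predicates `DHJ (Fin k)`, `k ≥ 1`. [cite: Polymath2012DHJ, Theorem 1.4] -/
theorem densityHalesJewett_of_dhj (h : ∀ k : ℕ, 1 ≤ k → DHJ (Fin k)) : DensityHalesJewett := by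
  intro k hk δ hδ
  obtain ⟨N, hN⟩ := h k hk δ hδ
  refine ⟨N, fun n hn A hA => ?_⟩
  refine hN (Fin n) (by simpa using hn) A ?_
  have hK : (0 : ℝ) < Fintype.card (Fin n → Fin k) := by
    rw [Fintype.card_fun, Fintype.card_fin, Fintype.card_fin]
    exact_mod_cast pow_pos (by omega) n
  rw [rdens_def, le_div_iff₀ hK]
  have hcard : (Fintype.card (Fin n → Fin k) : ℝ) = (k : ℝ) ^ n := by
    rw [Fintype.card_fun, Fintype.card_fin, Fintype.card_fin]; push_cast; ring
  rw [hcard]; exact hA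

/-! ### Fibres and iterated splittings -/

/-- Fibre over an empty prefix: `rdens (A_x) = rdens A` when the prefix coordinate set is empty.
[folklore] -/
theorem rdens_fiber_of_isEmpty {α β γ : Type*} [Fintype α] [DecidableEq α] [Nonempty α] [Fintype β]
    [DecidableEq β] [IsEmpty β] [Fintype γ] [DecidableEq γ] (A : Finset (β ⊕ γ → α)) (x : β → α) :
    rdens (fiber A x) = rdens A := by
  rw [rdens_eq_sum_rdens_fiber_div A]
  have huniv : (univ : Finset (β → α)) = {x} := by
    ext y; simp only [mem_univ, mem_singleton, true_iff]; funext b; exact isEmptyElim b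
  rw [huniv, sum_singleton, Fintype.card_fun, Fintype.card_eq_zero (α := β), pow_zero]
  simp

/-- Re-splitting: the fibre of `A` over `x ⌢ z` (coordinates `(β ⊕ μ) ⊕ γ'`) equals the fibre over
`z` of the fibre over `x` (coordinates `β ⊕ (μ ⊕ γ')`), for the regrouping equivalence.
[folklore] -/
theorem fiber_fiber_eq {α ι β γ μ γ' : Type*} [Fintype α] [DecidableEq α] [Fintype β] [Fintype γ]
    [DecidableEq γ] [Fintype μ] [Fintype γ'] [DecidableEq γ'] (e : ι ≃ β ⊕ γ) (e₂ : γ ≃ μ ⊕ γ')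
    (A : Finset (ι → α)) (x : β → α) (z : μ → α) :
    fiber (transport (e.trans ((Equiv.sumCongr (Equiv.refl β) e₂).trans (Equiv.sumAssoc β μ γ').symm)) A)
        (Sum.elim x z) =
      fiber (transport e₂ (fiber (transport e A) x)) z := by
  ext y
  simp only [mem_fiber, mem_transport]
  have key : (Sum.elim (Sum.elim x z) y ∘
      (e.trans ((Equiv.sumCongr (Equiv.refl β) e₂).trans (Equiv.sumAssoc β μ γ').symm))) =
      (Sum.elim x (Sum.elim z y ∘ e₂)) ∘ e := by
    funext i
    simp only [Function.comp_apply, Equiv.trans_apply]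
    rcases e i with b | c
    · simp
    · simp only [Equiv.sumCongr_apply, Sum.map_inr, Sum.elim_inr, Function.comp_apply]
      rcases e₂ c with u | v
      · simp
      · simp
  rw [key]


/-- A finite type with at least `M` elements splits as `Fin M ⊕ Fin n` (the `M` block first).
[folklore] -/
theorem exists_equiv_fin_sum (ι : Type*) [Fintype ι] {M : ℕ} (hM : M ≤ Fintype.card ι) :
    ∃ (n : ℕ) (_ : ι ≃ Fin M ⊕ Fin n), M + n = Fintype.card ι := by
  obtain ⟨n, e, hn⟩ := exists_equiv_sum_fin ι hM
  exact ⟨n, e.trans (Equiv.sumComm _ _), by omega⟩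

/-! ### DKT Lemma 4: uniformization of a dense set on a subspace -/

/-- **The iteration behind DKT Lemma 4.** After `J` steps either an `m`-dimensional subspace `V`
(of the form `x₁⌢⋯⌢x_J⌢[k]^m`) all of whose fibres have density `≥ rdens A - ε` has been found, or
there is a prefix `x` of length `J m` whose fibre has density `≥ rdens A + J ρ`
(`ρ = ε/(k^m - 1)`). [cite: DodosKanellopoulosTyros2014, Lemma 4 (proof)] -/
theorem uniformization_iter {α : Type} [Fintype α] [DecidableEq α] [Nonempty α] (m : ℕ) {ε ρ : ℝ}
    (hρ : ((Fintype.card α : ℝ) ^ m - 1) * ρ = ε) (hρ0 : 0 ≤ ρ)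
    {ι : Type} [Fintype ι] [DecidableEq ι] (A : Finset (ι → α)) :
    ∀ J : ℕ, J * m ≤ Fintype.card ι →
      (∃ (β γ : Type) (_ : Fintype β) (_ : DecidableEq β) (_ : Fintype γ) (_ : DecidableEq γ)
          (e : ι ≃ β ⊕ γ) (V : Subspace (Fin m) α β),
          ∀ z, rdens A - ε ≤ rdens (fiber (transport e A) (V z))) ∨
      (∃ (β γ : Type) (_ : Fintype β) (_ : DecidableEq β) (_ : Fintype γ) (_ : DecidableEq γ)
          (e : ι ≃ β ⊕ γ) (x : β → α), Fintype.card ι ≤ Fintype.card γ + J * m ∧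
            rdens A + J * ρ ≤ rdens (fiber (transport e A) x)) := by
  intro J
  induction J with
  | zero =>
    intro _
    right
    refine ⟨Empty, ι, inferInstance, inferInstance, inferInstance, inferInstance,
      (Equiv.emptySum Empty ι).symm, fun b => b.elim, by simp, ?_⟩
    rw [Nat.cast_zero, zero_mul, add_zero, rdens_fiber_of_isEmpty, rdens_transport]
  | succ J ih =>
    intro hJ
    have hJ' : J * m ≤ Fintype.card ι := le_trans (Nat.mul_le_mul_right _ (Nat.le_succ J)) hJ
    rcases ih hJ' with h | ⟨β, γ, _, _, _, _, e, x, hcard, hdens⟩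
    · exact Or.inl h
    -- split off the next `m` coordinates of `γ`
    have hγm : m ≤ Fintype.card γ := by
      have : (J + 1) * m = J * m + m := by ring
      omega
    obtain ⟨n', e₂, hn'⟩ := exists_equiv_fin_sum γ hγm
    set B : Finset (Fin m ⊕ Fin n' → α) := transport e₂ (fiber (transport e A) x) with hB
    set d : (Fin m → α) → ℝ := fun z => rdens (fiber B z) with hd
    set D : ℝ := rdens A with hD
    set K : ℝ := (Fintype.card α : ℝ) ^ m with hK
    have hKcard : (Fintype.card (Fin m → α) : ℝ) = K := by
      rw [Fintype.card_fun, Fintype.card_fin]; push_cast; rfl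
    have havg : K * rdens B = ∑ z, d z := by
      rw [rdens_eq_sum_rdens_fiber_div B, hKcard]
      have hKpos : (0 : ℝ) < K := by rw [hK]; exact_mod_cast pow_pos Fintype.card_pos m
      field_simp
      rfl
    have hBdens : D + J * ρ ≤ rdens B := by rwa [hB, rdens_transport]
    set e' : ι ≃ (β ⊕ Fin m) ⊕ Fin n' :=
      e.trans ((Equiv.sumCongr (Equiv.refl β) e₂).trans (Equiv.sumAssoc β (Fin m) (Fin n')).symm)
      with he'
    have hfib : ∀ z, fiber (transport e' A) (Sum.elim x z) = fiber B z := fun z =>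
      fiber_fiber_eq e e₂ A x z
    by_cases hall : ∀ z, D - ε ≤ d z
    · left
      refine ⟨β ⊕ Fin m, Fin n', inferInstance, inferInstance, inferInstance, inferInstance, e',
        Subspace.vert x (Subspace.idSubspace α (Fin m)), fun z => ?_⟩
      rw [Subspace.vert_apply, Subspace.idSubspace_apply, hfib]
      exact hall z
    · right
      push Not at hall
      obtain ⟨z₀, hz₀⟩ := hall
      -- some fibre has density ≥ D + (J+1) ρ
      have hex : ∃ z₁, D + (J + 1 : ℕ) * ρ ≤ d z₁ := by
        by_contra hcon
        push Not at hcon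
        have hsum : ∑ z, d z = d z₀ + ∑ z ∈ univ.erase z₀, d z :=
          (add_sum_erase univ d (mem_univ z₀)).symm
        have hrest : ∑ z ∈ univ.erase z₀, d z ≤ (K - 1) * (D + (J + 1 : ℕ) * ρ) := by
          calc ∑ z ∈ univ.erase z₀, d z ≤ ∑ _z ∈ univ.erase z₀, (D + (J + 1 : ℕ) * ρ) :=
                sum_le_sum fun z _ => (hcon z).le
            _ = (K - 1) * (D + (J + 1 : ℕ) * ρ) := by
                rw [sum_const, nsmul_eq_mul, card_erase_of_mem (mem_univ _), card_univ,
                  Nat.cast_sub Fintype.card_pos, hKcard, Nat.cast_one]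
        have h1 : K * (D + J * ρ) ≤ ∑ z, d z := by
          rw [← havg]
          have hKpos : (0 : ℝ) ≤ K := by positivity
          exact mul_le_mul_of_nonneg_left hBdens hKpos
        push_cast at hrest h1 hcon
        have hJρ : (0 : ℝ) ≤ J * ρ := by positivity
        nlinarith
      obtain ⟨z₁, hz₁⟩ := hex
      refine ⟨β ⊕ Fin m, Fin n', inferInstance, inferInstance, inferInstance, inferInstance, e',
        Sum.elim x z₁, ?_, ?_⟩
      · rw [Fintype.card_fin]
        have : (J + 1) * m = J * m + m := by ring
        omega
      · rw [hfib]
        exact hz₁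

/-- **DKT Lemma 4 (uniformization).** Let `k = |α| ≥ 2`, `m ≥ 1`, `0 < ε`. If
`|ι| ≥ (⌊(k^m - 1)/ε⌋ + 2) m` then for every `A ⊆ α^ι` there are a splitting `ι ≃ β ⊕ γ` and an
`m`-dimensional subspace `V` of `α^β` such that every fibre `A_{V(z)} ⊆ α^γ` has density
`≥ rdens A - ε`. (DKT ask `n ≥ ε⁻¹ k^m m` and conclude with "some `l < n`"; the splitting `β ⊕ γ`
renders `[k]^l × [k]^{n-l}`.) [cite: DodosKanellopoulosTyros2014, Lemma 4] -/
theorem uniformization {α : Type} [Fintype α] [DecidableEq α] (hk : 2 ≤ Fintype.card α) {m : ℕ}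
    (hm : 1 ≤ m) {ε : ℝ} (hε : 0 < ε) {ι : Type} [Fintype ι] [DecidableEq ι]
    (hι : (⌊((Fintype.card α : ℝ) ^ m - 1) / ε⌋₊ + 2) * m ≤ Fintype.card ι) (A : Finset (ι → α)) :
    ∃ (β γ : Type) (_ : Fintype β) (_ : DecidableEq β) (_ : Fintype γ) (_ : DecidableEq γ)
      (e : ι ≃ β ⊕ γ) (V : Subspace (Fin m) α β),
      ∀ z, rdens A - ε ≤ rdens (fiber (transport e A) (V z)) := by
  haveI : Nonempty α := Fintype.card_pos_iff.1 (by omega)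
  set K : ℝ := (Fintype.card α : ℝ) ^ m with hK
  have hK1 : 1 < K := by
    have h2 : (2 : ℝ) ≤ Fintype.card α := by exact_mod_cast hk
    calc (1 : ℝ) < 2 := by norm_num
      _ ≤ (Fintype.card α : ℝ) := h2
      _ = (Fintype.card α : ℝ) ^ 1 := (pow_one _).symm
      _ ≤ K := pow_le_pow_right₀ (by linarith) hm
  set ρ : ℝ := ε / (K - 1) with hρdef
  have hρ0 : 0 < ρ := div_pos hε (by linarith)
  have hK1' : (K - 1) ≠ 0 := by linarith
  have hρ : (K - 1) * ρ = ε := by rw [hρdef]; field_simp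
  set J : ℕ := ⌊(K - 1) / ε⌋₊ + 2 with hJ
  rcases uniformization_iter m hρ hρ0.le A J hι with h | ⟨β, γ, _, _, _, _, e, x, _, hdens⟩
  · exact h
  · exfalso
    have h1 : rdens (fiber (transport e A) x) ≤ 1 := rdens_le_one _
    have h2 : 0 ≤ rdens A := rdens_nonneg _
    have h3 : (1 : ℝ) < J * ρ := by
      have hJgt : (K - 1) / ε < J := by
        rw [hJ]; push_cast
        have := Nat.lt_floor_add_one ((K - 1) / ε)
        linarith
      have : (K - 1) / ε * ρ = 1 := by
        rw [hρdef, div_mul_div_comm, mul_comm, div_self (mul_ne_zero hε.ne' hK1')]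
      calc (1 : ℝ) = (K - 1) / ε * ρ := this.symm
        _ < J * ρ := mul_lt_mul_of_pos_right hJgt hρ0
    linarith




/-! ### One more subspace constructor -/

/-- `W ⌢ ℓ`: an `m`-dimensional subspace on `β` followed by a line on `γ` is an
`(m+1)`-dimensional subspace on `β ⊕ γ` (DKT: "`V = W^⌢ ℓ`", proof of Prop. 3).
[cite: DodosKanellopoulosTyros2014, Proposition 3 (proof)] -/
def Subspace.snoc {α β γ : Type*} {m : ℕ} (W : Subspace (Fin m) α β) (l : Line α γ) :
    Subspace (Fin (m + 1)) α (β ⊕ γ) where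
  idxFun := Sum.elim (fun b => (W.idxFun b).map id Fin.castSucc)
    (fun c => (l.idxFun c).elim (Sum.inr (Fin.last m)) Sum.inl)
  proper e := by
    rcases Fin.eq_castSucc_or_eq_last e with ⟨j, rfl⟩ | rfl
    · obtain ⟨b, hb⟩ := W.proper j
      exact ⟨Sum.inl b, by simp [hb]⟩
    · obtain ⟨c, hc⟩ := l.proper
      exact ⟨Sum.inr c, by simp [hc]⟩

/-- `(W ⌢ ℓ)(x) = W(x ∘ castSucc) ⌢ ℓ(x last)`. [folklore] -/
@[simp] theorem Subspace.snoc_apply {α β γ : Type*} {m : ℕ} (W : Subspace (Fin m) α β) (l : Line α γ)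
    (x : Fin (m + 1) → α) :
    ⇑(Subspace.snoc W l) x = Sum.elim (W (fun j => x j.castSucc)) (l (x (Fin.last m))) := by
  funext i
  rcases i with b | c
  · simp only [Subspace.coe_apply, Subspace.snoc, Sum.elim_inl]
    cases W.idxFun b <;> simp
  · simp only [Subspace.coe_apply, Subspace.snoc, Sum.elim_inr, Line.coe_apply]
    cases l.idxFun c <;> simp

/-! ### Pigeonhole in the real-valued form used repeatedly -/

/-- Real-valued pigeonhole over the fibres of a map: some value is taken at least `#s / #t` times.
[folklore] -/
theorem exists_le_card_fiber_real {X Y : Type*} [DecidableEq Y] (s : Finset X) (t : Finset Y)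
    (ht : t.Nonempty) (f : X → Y) (hf : ∀ x ∈ s, f x ∈ t) :
    ∃ y ∈ t, (#s : ℝ) / #t ≤ #(s.filter fun x => f x = y) := by
  have hsum : ∑ y ∈ t, (#(s.filter fun x => f x = y) : ℝ) = #s := by
    exact_mod_cast (card_eq_sum_card_fiberwise hf).symm
  have htpos : (0 : ℝ) < #t := by exact_mod_cast ht.card_pos
  refine exists_le_of_sum_le ht ?_
  rw [sum_const, nsmul_eq_mul, hsum]
  field_simp
  rfl

/-! ### DKT Proposition 3: the multidimensional version from DHJ -/

/-- **DKT Proposition 3.** `DHJ α` implies its multidimensional version `MDHJ α m` for every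
`m ≥ 1`: split off the last `M = dhj(δ/2)` coordinates, find for a density-`δ/2` set of prefixes
`x` a line `ℓ_x ⊆ A_x`, pigeonhole the `≤ (k+1)^M` lines, and apply the inductive hypothesis to
the prefixes sharing the most popular line. [cite: DodosKanellopoulosTyros2014, Proposition 3] -/
theorem mdhj_of_dhj {α : Type} [Fintype α] [DecidableEq α] [Nonempty α] (h : DHJ α) :
    ∀ m : ℕ, 1 ≤ m → MDHJ α m := by
  intro m hm
  induction m, hm using Nat.le_induction with
  | base =>
    intro δ hδ
    obtain ⟨N, hN⟩ := h δ hδ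
    refine ⟨N, fun ι _ _ hι A hA => ?_⟩
    obtain ⟨l, hl⟩ := hN ι hι A hA
    exact ⟨Subspace.lineToSubspaceFinOne l, fun x => by
      rw [Subspace.lineToSubspaceFinOne_apply]; exact hl _⟩
  | succ m hm ih =>
    intro δ hδ
    obtain ⟨M, hM⟩ := h (δ / 2) (half_pos hδ)
    set L : ℝ := ((Fintype.card α : ℝ) + 1) ^ M with hL
    have hLpos : 0 < L := by positivity
    set c : ℝ := δ / 2 / L with hc
    have hcpos : 0 < c := by positivity
    obtain ⟨Nm, hNm⟩ := ih c hcpos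
    refine ⟨Nm + M, fun ι _ _ hι A hA => ?_⟩
    classical
    -- split off the last `M` coordinates
    obtain ⟨n, e, hn⟩ := exists_equiv_sum_fin ι (M := M) (by omega)
    set A' : Finset (Fin n ⊕ Fin M → α) := transport e A with hA'
    have hA'd : δ ≤ rdens A' := by rwa [hA', rdens_transport]
    -- the dense set of good prefixes
    set B : Finset (Fin n → α) := univ.filter fun x => δ / 2 ≤ rdens (fiber A' x) with hB
    have hKpos : (0 : ℝ) < Fintype.card (Fin n → α) := by exact_mod_cast card_cube_pos
    have hBcard : δ / 2 * Fintype.card (Fin n → α) ≤ #B := by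
      have hsum : δ * #(univ : Finset (Fin n → α)) ≤ ∑ x, rdens (fiber A' x) := by
        have h1 := rdens_eq_sum_rdens_fiber_div A'
        rw [eq_div_iff hKpos.ne'] at h1
        rw [card_univ, ← h1]
        exact mul_le_mul_of_nonneg_right hA'd hKpos.le
      have := le_card_filter_of_le_sum univ (fun x => rdens (fiber A' x)) (fun x _ => rdens_le_one _)
        (half_pos hδ).le hsum
      rw [card_univ] at this
      convert this using 1; ring
    -- a line in each good fibre, and the most popular one
    have hline : ∀ x ∈ B, ∃ l : Line α (Fin M), ∀ a, l a ∈ fiber A' x := fun x hx =>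
      hM (Fin M) (by simp) (fiber A' x) (mem_filter.1 hx).2
    let f : (Fin n → α) → (Fin M → Option α) := fun x =>
      if hx : x ∈ B then (Classical.choose (hline x hx)).idxFun else fun _ => none
    obtain ⟨w₀, -, hw₀⟩ := exists_le_card_fiber_real B (univ : Finset (Fin M → Option α))
      univ_nonempty f (fun _ _ => mem_univ _)
    set C : Finset (Fin n → α) := B.filter fun x => f x = w₀ with hC
    have hCcard : c * Fintype.card (Fin n → α) ≤ #C := by
      have hLcard : (#(univ : Finset (Fin M → Option α)) : ℝ) = L := by
        rw [card_univ, Fintype.card_fun, Fintype.card_option, Fintype.card_fin]; push_cast; ring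
      rw [hLcard] at hw₀
      calc c * Fintype.card (Fin n → α) = δ / 2 * Fintype.card (Fin n → α) / L := by
            rw [hc]; ring
        _ ≤ #B / L := by gcongr
        _ ≤ #C := hw₀
    have hCdens : c ≤ rdens C := by
      rw [rdens_def, le_div_iff₀ hKpos]; exact hCcard
    have hCne : C.Nonempty := by
      rw [← card_pos]
      have : (0 : ℝ) < #C := lt_of_lt_of_le (by positivity) hCcard
      exact_mod_cast this
    obtain ⟨x₀, hx₀⟩ := hCne
    have hx₀B : x₀ ∈ B := (mem_filter.1 hx₀).1
    set l : Line α (Fin M) := Classical.choose (hline x₀ hx₀B) with hl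
    have hlw : l.idxFun = w₀ := by
      have := (mem_filter.1 hx₀).2
      simp only [f, dif_pos hx₀B] at this
      exact this
    have hlC : ∀ x ∈ C, ∀ a, l a ∈ fiber A' x := by
      intro x hx a
      have hxB : x ∈ B := (mem_filter.1 hx).1
      have hfx : f x = w₀ := (mem_filter.1 hx).2
      simp only [f, dif_pos hxB] at hfx
      have heq : Classical.choose (hline x hxB) = l := Line.ext (by rw [hfx, hlw])
      have := Classical.choose_spec (hline x hxB) a
      rwa [heq] at this
    -- the inductive hypothesis on the prefixes
    obtain ⟨W, hW⟩ := hNm (Fin n) (by simp; omega) C hCdens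
    refine ⟨subspaceReindex (Subspace.snoc W l) e.symm, fun x => ?_⟩
    have hmem : ⇑(Subspace.snoc W l) x ∈ A' := by
      rw [Subspace.snoc_apply, ← mem_fiber]
      exact hlC _ (hW _) _
    rw [hA', mem_transport] at hmem
    rw [subspaceReindex_apply, Equiv.symm_symm]
    exact hmem

/-! ### DKT Corollary 5: subspaces of `[k+1]^n` whose `[k]`-part lies in a dense set -/

/-- **DKT Corollary 5.** Assume `DHJ α` (`k = |α| ≥ 1`; DKT assume `k ≥ 2`), `m ≥ 1`, `δ > 0`. For all large `ι`,
every `A ⊆ (Option α)^ι` of density `≥ δ` contains `V ↾ k` for some `m`-dimensional subspace `V`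
of `(Option α)^ι`, i.e. `V(some ∘ z) ∈ A` for all `z ∈ α^m`.
[cite: DodosKanellopoulosTyros2014, Corollary 5] -/
theorem mdhjStar_of_dhj {α : Type} [Fintype α] [DecidableEq α] (hk : 1 ≤ Fintype.card α)
    (h : DHJ α) {m : ℕ} (hm : 1 ≤ m) {δ : ℝ} (hδ : 0 < δ) :
    ∃ N : ℕ, ∀ (ι : Type) [Fintype ι] [DecidableEq ι], N ≤ Fintype.card ι →
      ∀ A : Finset (ι → Option α), δ ≤ rdens A →
        ∃ V : Subspace (Fin m) (Option α) ι, ∀ z : Fin m → α, V (some ∘ z) ∈ A := by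
  haveI : Nonempty α := Fintype.card_pos_iff.1 (by omega)
  obtain ⟨M₀, hM₀⟩ := mdhj_of_dhj h m hm (δ / 2) (half_pos hδ)
  set M : ℕ := max M₀ 1 with hMdef
  have hM1 : 1 ≤ M := le_max_right _ _
  refine ⟨(⌊(((Fintype.card (Option α) : ℝ)) ^ M - 1) / (δ / 2)⌋₊ + 2) * M, fun ι _ _ hι A hA => ?_⟩
  classical
  have hk' : 2 ≤ Fintype.card (Option α) := by rw [Fintype.card_option]; omega
  obtain ⟨β, γ, _, _, _, _, e, W, hW⟩ := uniformization hk' hM1 (half_pos hδ) hι A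
  set A' : Finset (β ⊕ γ → Option α) := transport e A with hA'
  have hAd : rdens A' = rdens A := rdens_transport e A
  -- count pairs `(z, y)` with `W(some ∘ z) ⌢ y ∈ A'`
  have hKγ : (0 : ℝ) < Fintype.card (γ → Option α) := by exact_mod_cast card_cube_pos
  have hsum : ∑ z : Fin M → α, (#(fiber A' (W (some ∘ z))) : ℝ) ≥
      Fintype.card (Fin M → α) * (δ / 2 * Fintype.card (γ → Option α)) := by
    have : ∀ z : Fin M → α, δ / 2 * Fintype.card (γ → Option α) ≤ #(fiber A' (W (some ∘ z))) := by
      intro z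
      rw [card_eq_rdens_mul]
      refine mul_le_mul_of_nonneg_right ?_ hKγ.le
      have := hW (some ∘ z)
      rw [hA'] at this ⊢
      linarith [rdens_transport e A]
    calc ∑ z : Fin M → α, (#(fiber A' (W (some ∘ z))) : ℝ)
        ≥ ∑ _z : Fin M → α, δ / 2 * Fintype.card (γ → Option α) := sum_le_sum fun z _ => this z
      _ = _ := by rw [sum_const, card_univ, nsmul_eq_mul]
  have hswap : ∑ z : Fin M → α, (#(fiber A' (W (some ∘ z))) : ℝ) =
      ∑ y : γ → Option α, (#(univ.filter fun z : Fin M → α => Sum.elim (W (some ∘ z)) y ∈ A') : ℝ) := by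
    have : ∑ z : Fin M → α, #(fiber A' (W (some ∘ z))) =
        ∑ y : γ → Option α, #(univ.filter fun z : Fin M → α => Sum.elim (W (some ∘ z)) y ∈ A') := by
      simp only [fiber, card_filter]
      exact sum_comm
    exact_mod_cast this
  obtain ⟨y₀, -, hy₀⟩ : ∃ y₀ ∈ (univ : Finset (γ → Option α)),
      δ / 2 * Fintype.card (Fin M → α) ≤
        #(univ.filter fun z : Fin M → α => Sum.elim (W (some ∘ z)) y₀ ∈ A') := by
    refine exists_le_of_sum_le univ_nonempty ?_
    rw [sum_const, card_univ, nsmul_eq_mul, ← hswap]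
    linarith [hsum]
  set C : Finset (Fin M → α) := univ.filter fun z : Fin M → α => Sum.elim (W (some ∘ z)) y₀ ∈ A' with hC
  have hCd : δ / 2 ≤ rdens C := by
    have hKM : (0 : ℝ) < Fintype.card (Fin M → α) := by exact_mod_cast card_cube_pos
    rw [rdens_def, le_div_iff₀ hKM]; exact hy₀
  obtain ⟨V₀, hV₀⟩ := hM₀ (Fin M) (by simp [hMdef]) C hCd
  refine ⟨subspaceReindex (Subspace.horiz (Subspace.comp W (Subspace.mapLetters some V₀)) y₀) e.symm,
    fun z => ?_⟩
  have hmem : ⇑(Subspace.horiz (Subspace.comp W (Subspace.mapLetters some V₀)) y₀) (some ∘ z) ∈ A' := by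
    rw [Subspace.horiz_apply, Subspace.comp_apply, Subspace.mapLetters_apply]
    exact (mem_filter.1 (hV₀ z)).2
  rw [hA', mem_transport] at hmem
  rw [subspaceReindex_apply, Equiv.symm_symm]
  exact hmem


end Literature.Combinatorics.HalesJewett
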